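import Literature.NumberTheory.GelbartRogawski1991.DoubledWeilRepresentationArchLagrangianGen
import Literature.NumberTheory.GelbartRogawski1991.DoubledUnitarySiegelParabolicAlgebraGen
import Literature.NumberTheory.Automorphic.UnitaryGroupArchSiegelSquares
import Literature.NumberTheory.GelbartRogawski1991.LocalDoubledUnitaryResidueWitness
import Literature.NumberTheory.GelbartRogawski1991.DoubledWeilRepresentationArchLift
import Literature.NumberTheory.Weil1964.ArchLiftParabolicValue
import Literature.NumberTheory.Weil1964.AdelicMetaplecticScalarTwist
import HarnessLib

/-!
# The doubled Weil representation, archimedean half (II): a Folland-framed section, twisted by a character matching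
# `χ` on the Siegel parabolic, is an archimedean half with the prescribed parabolic normalisation — general `E/F`, `E` totally complex

General-quadratic-extension twin (namespace `GRConstructionGen`) of `DoubledWeilRepresentationArchLift` (CM case,
namespace `GRConstruction`): the CM field `L ⊃ L⁺` with complex conjugation and `realDiagonal` Gram data is replaced by an
arbitrary quadratic extension `E/F` of number fields with `c ∈ Aut(E/F)`, `c δ = -δ ≠ 0`, `δ² = d ∈ F`, and symmetric
invertible Gram matrices `TV`, `TW` over `F` (objects of `DoubledUnitaryGlobalSplittingDataGen`).  Two differences: (1) the
archimedean MODULUS input (`0 < det A = modDelta²` for the diagonal action `A` of `ι^𝔻(g,1)`, `g ∈ P_Δ(F ⊗ ℝ)`; at CM data the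
theorem `DoubledUnitaryArchSiegelDiagonalModulus.exists_archAct_diagPair_det_eq_modDelta_sq`) is the HYPOTHESIS `hdiag` of §3, §5,
§6; (2) the squares argument of §4/§6 is stated for `E` TOTALLY COMPLEX (`[IsTotallyComplex E]`, any `F`: then
`P_Δ(F ⊗ ℝ) ≅ ∏_w GL_n(ℂ) ⋉ Herm_n` is square-generated; real places of `E` are excluded there).  Otherwise statements and
proofs are verbatim transports (generic group lemmas reused from the CM file).
([GelbartRogawski1991, §3.1 Prop. 3.1.1 p. 455]: archimedean places of the kernel construction of the compatible
splitting; [Kudla1994, §3]: the Siegel-parabolic character `χ(x(p)) |x(p)|^{1/2}`; [Weil1964, Chap. III n° 46 (42)]: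
the value at the origin of an implementer of a Siegel-parabolic element)

Topic `NumberTheory/GelbartRogawski1991`; namespace `Literature.NumberTheory.GelbartRogawski1991.GRConstruction`
(the vocabulary of `DoubledUnitaryGlobalSplittingData`: `gramDA`, `hermD`, `HA`, `IsSiegelDelta`, `detDelta`, `chiDet`,
`modDelta`, `toSpD`, `projD`, `rDelta`, `opD`, `MpD`, `ParabolicPrescribed`, `IsArchHalf`).  KERNEL only: proved
theorems; no definition, no named fact, no `sorry`.

Setting.  `H(L⁺ ⊗ ℝ) = U(J^𝔻)(L ⊗ ℝ)` (`UnitaryGroup.arch`), the inclusion `jA = (·, 1) : H(L⁺ ⊗ ℝ) →* H(𝔸)` (`hjA`; a variable typed into `H(𝔸)`), `ι^𝔻 ∘ jA : H(L⁺ ⊗ ℝ) → Sp(𝕎^𝔻_𝔸)`, a real frame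
`eW : (L⁺ ⊗ ℝ)^{n+n} ≃L[ℝ] ℝ^σ` of `𝕎^𝔻_∞`, and a section `sW : H(L⁺ ⊗ ℝ) →* Mp^𝓢(ℝ^σ)` (Folland's metaplectic group
realised on `𝓢(ℝ^σ)`) READ in the frame: `archPhaseMap eW (ι^𝔻(g, 1)) = π(sW g)` (`hdict`; `hfin`: `ι^𝔻(g,1)` fixes the
finite vectors).  The tree's `Weil1964.archLift` turns `(eW, sW)` into `sa : H(L⁺ ⊗ ℝ) →* Mp(𝕎^𝔻)ᶜᵒⁿᵗ`,
`g ↦ (ι^𝔻(g,1), (eW^* sW(g) eW_*) ⊗ 1)` (`hsa`).  For a character `η` of `H(L⁺ ⊗ ℝ)` write `sa ⊗ η` for the scalar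
twist (`adelicMpCont.twist`).

* §1 `sa ⊗ η` has the three structural fields of `IsArchHalf` (continuity, `π ∘ (sa ⊗ η) = ι^𝔻 ∘ (·,1)`, archimedean
  operators `(η(g) A_g) ⊗ 1`) for every continuous `η` (`isArchHalf_twist`);
* §2 bookkeeping on `P_Δ(L⁺ ⊗ ℝ)`: the conjugate `r_δ (sa ⊗ η)(g) r_δ⁻¹` is multiplicative and equals
  `(1, η g) · r_δ sa(g) r_δ⁻¹`; the prescribed scalar `χ(det_Δ (g,1)) |det_Δ (g,1)|^{1/2}` is multiplicative and `≠ 0`;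
* §3 the `𝕐`-block `d` of `δ ι^𝔻(g,1) δ⁻¹` at `∞` has `0 < det d` and `det d = |det_Δ (g,1)|` (`det_yBlock_eq_det` of
  part (I) with the diagonal action of `DoubledUnitaryArchSiegelDiagonalModulus`);
* §4 every element of `P_Δ(L⁺ ⊗ ℝ)` is a product of squares of elements of `P_Δ(L⁺ ⊗ ℝ)`
  (`UnitaryGroupArchSiegelSquares`), and two multiplicative scalars on a square-generated set with equal squares agree;
* §5 **`exists_originValue_sq`** — on `P_Δ(L⁺ ⊗ ℝ)` the origin value of `r_δ (sa ⊗ η)(g) r_δ⁻¹` is a scalar `κ_g` with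
  `κ_g² = (χ(det_Δ)|det_Δ|^{1/2})²`, PROVIDED `η(g)² · quot(sW g) = χ(det_Δ (g,1))²` (`hη`; `quot` = Folland's quotient
  character of `Mp^𝓢`): Weil's formula for the value at `0` of an implementer of `m(a) n(b)`
  (`ArchLiftParabolicValue.exists_siegel_of_conj`: `= u · |det a|^{-1/2}`, `u² = quot`) and §3;
* §6 **`parabolicPrescribed_twist`** — hence `κ_g = χ(det_Δ (g,1)) |det_Δ (g,1)|^{1/2}` exactly (§4: both sides are
  multiplicative on `P_Δ(L⁺ ⊗ ℝ)` with equal squares), i.e. `ParabolicPrescribed χ (sa ⊗ η)`; and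
  **`isArchHalf_twist_archLift`** — `sa ⊗ η` is an archimedean half `IsArchHalf χ (sa ⊗ η)`.

The sequel `DoubledWeilRepresentationArchHalf` instantiates `(eW, sW)` with Folland's `det^{1/2}`-normalised unitary
section in the scaled frame (`Weil1964.ArchUnitaryWeilHalf`) and `η = ∏_w det(g_w)^{(e_w+1)/2}`
(`DoubledWeilRepresentationArchTwist`).  Written for the stage-1 cell `pub-hodgecm` (seat GR-3); nothing here is a claim
of the manuscripts adjudicated by that cell.

## References

* S. Gelbart, J. Rogawski, *L-functions and Fourier–Jacobi coefficients for the unitary group U(3)*, Invent. Math. 105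
  (1991), §3.1 Prop. 3.1.1 p. 455 [GelbartRogawski1991].
* S. S. Kudla, *Splitting metaplectic covers of dual reductive pairs*, Israel J. Math. 87 (1994) 361–401, §3
  [Kudla1994].
* A. Weil, *Sur certains groupes d'opérateurs unitaires*, Acta Math. 111 (1964), Chap. III n° 46 (42) p. 202
  [Weil1964].
* G. B. Folland, *Harmonic Analysis in Phase Space*, Princeton UP 1989, §4.2 (4.24), (4.36)–(4.37) [Folland1989].
-/

set_option autoImplicit false

noncomputable section

open scoped Classical
open scoped Matrix Kronecker TensorProduct
open NumberField IsDedekindDomain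
open Literature.RepresentationTheory.HeisenbergGroup
open Literature.NumberTheory.Automorphic
open Literature.NumberTheory.Weil1964
open Literature.NumberTheory.GaloisRepresentations
open Literature.Analysis.SegalBargmann

namespace Literature.NumberTheory.GelbartRogawski1991.GRConstructionGen

open UnitaryDualPair

variable (F : Type) [Field F] [NumberField F] (E : Type) [Field E] [NumberField E] [Algebra F E]
  [Algebra.IsQuadraticExtension F E]
variable (c : E ≃ₐ[F] E) {δ : E} (hcδ : c δ = -δ) (hδ : δ ≠ 0) {d : F} (hd : δ * δ = algebraMap F E d)
variable {N M n : ℕ} (e : Fin N × Fin M ≃ Fin n)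
  (TV : Matrix (Fin N) (Fin N) F) (hV : TV.IsSymm) (hVd : IsUnit TV.det)
  (TW : Matrix (Fin M) (Fin M) F) (hW : TW.IsSymm) (hWd : IsUnit TW.det)

variable (jA : UnitaryGroup.arch F E c (n + n) (hermD F E e TV TW) →* HA F E c e TV TW)
  (hjA : jA = UnitaryGroup.archToAdelic F E c (n + n) (hermD F E e TV TW))

variable {σ : Type*} [Fintype σ]
  (eW : (Fin (n + n) → mixedEmbedding.mixedSpace F) ≃L[ℝ] (σ → ℝ))
  (sW : UnitaryGroup.arch F E c (n + n) (hermD F E e TV TW) →* MpS σ)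
  (hfin : ∀ (g : UnitaryGroup.arch F E c (n + n) (hermD F E e TV TW)) (k k' : Fin (n + n) → FiniteAdeleRing (𝓞 F) F),
    (((toSpD F E c hcδ hδ hd e TV hV TW hW).comp jA) g).1 (finVec k, finVec k') = (finVec k, finVec k'))
  (hdict : ∀ g : UnitaryGroup.arch F E c (n + n) (hermD F E e TV TW),
    archPhaseMap (gramDA F e TV TW) eW (isUnit_archMat_gramDA F e TV hVd TW hWd) (((toSpD F E c hcδ hδ hd e TV hV TW hW).comp jA) g) =
      ⇑((MpS.proj (sW g)).1 : ((σ → ℝ) × (σ → ℝ)) ≃ₗ[ℝ] ((σ → ℝ) × (σ → ℝ))))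
  (sa : UnitaryGroup.arch F E c (n + n) (hermD F E e TV TW) →* MpD F e TV TW)
  (hsa : sa = archLift (gramDA F e TV TW) eW (isUnit_archMat_gramDA F e TV hVd TW hWd)
        ((toSpD F E c hcδ hδ hd e TV hV TW hW).comp jA) sW hfin hdict)
  -- the archimedean MODULUS input (at CM data: `DoubledUnitaryArchSiegelDiagonalModulus.exists_archAct_diagPair_det_eq_modDelta_sq`)
  (hdiag : ∀ g : UnitaryGroup.arch F E c (n + n) (hermD F E e TV TW), IsSiegelDelta F E c e TV TW (jA g) →
    ∃ A : ((Fin n → mixedEmbedding.mixedSpace F) × (Fin n → mixedEmbedding.mixedSpace F)) ≃ₗ[ℝ]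
        ((Fin n → mixedEmbedding.mixedSpace F) × (Fin n → mixedEmbedding.mixedSpace F)),
      (∀ az : (Fin n → mixedEmbedding.mixedSpace F) × (Fin n → mixedEmbedding.mixedSpace F),
        archAct (gramDA F e TV TW) (((toSpD F E c hcδ hδ hd e TV hV TW hW).comp jA) g)
            (Sum.elim az.1 az.1 ∘ ⇑(e₂ (n := n)).symm, Sum.elim az.2 az.2 ∘ ⇑(e₂ (n := n)).symm) =
          (Sum.elim (A az).1 (A az).1 ∘ ⇑(e₂ (n := n)).symm, Sum.elim (A az).2 (A az).2 ∘ ⇑(e₂ (n := n)).symm)) ∧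
      0 < LinearMap.det (A : ((Fin n → mixedEmbedding.mixedSpace F) × (Fin n → mixedEmbedding.mixedSpace F)) →ₗ[ℝ]
        ((Fin n → mixedEmbedding.mixedSpace F) × (Fin n → mixedEmbedding.mixedSpace F))) ∧
      ((LinearMap.det (A : ((Fin n → mixedEmbedding.mixedSpace F) × (Fin n → mixedEmbedding.mixedSpace F)) →ₗ[ℝ]
          ((Fin n → mixedEmbedding.mixedSpace F) × (Fin n → mixedEmbedding.mixedSpace F))) : ℝ) : ℂ) =
        ((modDelta F E c e TV TW (jA g) : ℝ) : ℂ) ^ 2)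

/-! ## §1 The three structural fields survive any twist -/

section Structural

omit [Algebra.IsQuadraticExtension F E] in
/-- `c • (A ⊗ 1) = (c • A) ⊗ 1`. [cite: GelbartRogawski1991, §3.1 Prop. 3.1.1 p. 455] -/
theorem smul_adelicTensorEnd_id (c : ℂ) (A : SchwartzMap (Fin (n + n) → mixedEmbedding.mixedSpace F) ℂ →ₗ[ℂ] SchwartzMap (Fin (n + n) → mixedEmbedding.mixedSpace F) ℂ) :
    c • adelicTensorEnd A (LinearMap.id : FinSB F (Fin (n + n)) →ₗ[ℂ] FinSB F (Fin (n + n))) =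
      adelicTensorEnd (c • A) LinearMap.id := by
  refine LinearMap.ext fun Ψ => ?_
  obtain ⟨z, rfl⟩ := (piSchwartzBruhatEquiv F (Fin (n + n))).surjective Ψ
  induction z using TensorProduct.induction_on with
  | zero => simp only [map_zero]
  | tmul Φ f =>
    rw [LinearMap.smul_apply, adelicTensorEnd_apply_tmul, adelicTensorEnd_apply_tmul, LinearMap.smul_apply,
      ← map_smul, TensorProduct.smul_tmul']
  | add z₁ z₂ h₁ h₂ => rw [map_add, map_add, map_add, h₁, h₂]

include hsa in
set_option maxHeartbeats 3200000 in
-- (instance unification on `𝓢`/`Mp(𝕎^𝔻)ᶜᵒⁿᵗ` operators is expensive)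
/-- **`ω((sa ⊗ η)(g)) = (η(g) A_g) ⊗ 1` is archimedean.** [cite: GelbartRogawski1991, §3.1 Prop. 3.1.1 p. 455] -/
theorem isArch_twist (η : UnitaryGroup.arch F E c (n + n) (hermD F E e TV TW) →* ℂˣ) (g : UnitaryGroup.arch F E c (n + n) (hermD F E e TV TW)) :
    ∃ A : SchwartzMap (Fin (n + n) → mixedEmbedding.mixedSpace F) ℂ →L[ℂ] SchwartzMap (Fin (n + n) → mixedEmbedding.mixedSpace F) ℂ,
      (adelicMpCont.omega F (Fin (n + n)) (gramDA F e TV TW) (adelicMpCont.twist F (Fin (n + n)) (gramDA F e TV TW) sa η g) : piSchwartzBruhat F (Fin (n + n)) →ₗ[ℂ] piSchwartzBruhat F (Fin (n + n))) =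
        adelicTensorEnd (A : SchwartzMap (Fin (n + n) → mixedEmbedding.mixedSpace F) ℂ →ₗ[ℂ] SchwartzMap (Fin (n + n) → mixedEmbedding.mixedSpace F) ℂ) LinearMap.id := by
  have h1 : (adelicMpCont.omega F (Fin (n + n)) (gramDA F e TV TW) (adelicMpCont.twist F (Fin (n + n)) (gramDA F e TV TW) sa η g) : piSchwartzBruhat F (Fin (n + n)) →ₗ[ℂ] piSchwartzBruhat F (Fin (n + n))) =
      ((η g : ℂˣ) : ℂ) • (adelicMpCont.omega F (Fin (n + n)) (gramDA F e TV TW) (sa g) : piSchwartzBruhat F (Fin (n + n)) →ₗ[ℂ] piSchwartzBruhat F (Fin (n + n))) :=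
    LinearMap.ext fun Ψ => by
      rw [LinearMap.smul_apply]
      exact adelicMpCont.omega_twist sa η g Ψ
  subst hsa
  obtain ⟨A, hA⟩ := isArch_archLift (gramDA F e TV TW) eW (isUnit_archMat_gramDA F e TV hVd TW hWd)
    ((toSpD F E c hcδ hδ hd e TV hV TW hW).comp jA) sW hfin hdict g
  refine ⟨((η g : ℂˣ) : ℂ) • A, ?_⟩
  rw [h1, hA, smul_adelicTensorEnd_id, ContinuousLinearMap.toLinearMap_smul]

include hsa hjA in
set_option maxHeartbeats 800000 in
/-- **the three structural fields survive any twist**: for every continuous character `η` of `H(L⁺ ⊗ ℝ)` with the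
parabolic prescription, `sa ⊗ η` is an archimedean half. [cite: GelbartRogawski1991, §3.1 Prop. 3.1.1 p. 455] -/
theorem isArchHalf_twist (χ : HeckeCharacter E) (hcont : Continuous sa) (η : UnitaryGroup.arch F E c (n + n) (hermD F E e TV TW) →* ℂˣ)
    (hηc : Continuous fun g => ((η g : ℂˣ) : ℂ))
    (hpar : ParabolicPrescribed F E c e TV hVd TW hWd jA χ (adelicMpCont.twist F (Fin (n + n)) (gramDA F e TV TW) sa η)) :
    IsArchHalf F E c hcδ hδ hd e TV hV hVd TW hW hWd χ (adelicMpCont.twist F (Fin (n + n)) (gramDA F e TV TW) sa η) where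
  continuous := adelicMpCont.continuous_twist sa η hcont hηc
  proj_eq g := by
    subst hjA hsa
    exact (adelicMpCont.proj_twist _ _ g).trans rfl
  isArch g := isArch_twist F E c hcδ hδ hd e TV hV hVd TW hW hWd jA eW sW hfin hdict sa hsa η g
  parabolic := by
    subst hjA
    exact hpar

end Structural

/-! ## §2 Bookkeeping on `P_Δ(L⁺ ⊗ ℝ)`: the conjugated twist and the prescribed scalar -/

section Prescribed

set_option maxHeartbeats 800000 in
omit [NumberField E] [Algebra.IsQuadraticExtension F E] in
/-- `g ↦ r_δ (sa ⊗ η)(g) r_δ⁻¹` is multiplicative. [cite: GelbartRogawski1991, §3.1 Prop. 3.1.1 p. 455] -/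
theorem conj_twist_mul (η : UnitaryGroup.arch F E c (n + n) (hermD F E e TV TW) →* ℂˣ) (p q : UnitaryGroup.arch F E c (n + n) (hermD F E e TV TW)) :
    (rDelta F e TV hVd TW hWd * adelicMpCont.twist F (Fin (n + n)) (gramDA F e TV TW) sa η (p * q) * (rDelta F e TV hVd TW hWd)⁻¹) =
      (rDelta F e TV hVd TW hWd * adelicMpCont.twist F (Fin (n + n)) (gramDA F e TV TW) sa η p * (rDelta F e TV hVd TW hWd)⁻¹) *
        (rDelta F e TV hVd TW hWd * adelicMpCont.twist F (Fin (n + n)) (gramDA F e TV TW) sa η q * (rDelta F e TV hVd TW hWd)⁻¹) :=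
  (congrArg (fun t => rDelta F e TV hVd TW hWd * t * (rDelta F e TV hVd TW hWd)⁻¹) ((adelicMpCont.twist F (Fin (n + n)) (gramDA F e TV TW) sa η).map_mul p q)).trans (GRConstruction.conj_mul_general _ _ _)

set_option maxHeartbeats 800000 in
omit [NumberField E] [Algebra.IsQuadraticExtension F E] in
/-- `r_δ (sa ⊗ η)(g) r_δ⁻¹ = (1, η g) · (r_δ sa(g) r_δ⁻¹)`. [cite: GelbartRogawski1991, §3.1 Prop. 3.1.1 p. 455] -/
theorem conj_twist_eq (η : UnitaryGroup.arch F E c (n + n) (hermD F E e TV TW) →* ℂˣ) (g : UnitaryGroup.arch F E c (n + n) (hermD F E e TV TW)) :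
    (rDelta F e TV hVd TW hWd * adelicMpCont.twist F (Fin (n + n)) (gramDA F e TV TW) sa η g * (rDelta F e TV hVd TW hWd)⁻¹) =
      adelicMpCont.ofScalar F (Fin (n + n)) (gramDA F e TV TW) (η g) * (rDelta F e TV hVd TW hWd * sa g * (rDelta F e TV hVd TW hWd)⁻¹) :=
  (congrArg (fun t => rDelta F e TV hVd TW hWd * t * (rDelta F e TV hVd TW hWd)⁻¹) (adelicMpCont.twist_apply sa η g)).trans
    (GRConstruction.conj_central_general _ _ _ (adelicMpCont.mul_ofScalar_comm (η g) (rDelta F e TV hVd TW hWd)))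

omit [NumberField F] [Algebra.IsQuadraticExtension F E] in
/-- `|det_Δ p|^{1/2} ≠ 0`. [cite: Kudla1994, §3] -/
theorem modDelta_ne_zero (p : HA F E c e TV TW) : modDelta F E c e TV TW p ≠ 0 := by
  unfold modDelta
  split_ifs with hu
  · rw [← coe_ideleNorm]
    exact Real.sqrt_ne_zero'.2 (NNReal.coe_pos.2 (pos_iff_ne_zero.2 (ideleNorm_ne_zero _)))
  · exact one_ne_zero

omit [NumberField F] [Algebra.IsQuadraticExtension F E] in
/-- the prescribed scalar `χ(det_Δ (g,1)) |det_Δ (g,1)|^{1/2}` is multiplicative on `P_Δ(L⁺ ⊗ ℝ)`. [cite: Kudla1994, §3] -/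
theorem prescribed_mul (χ : HeckeCharacter E) {p q : UnitaryGroup.arch F E c (n + n) (hermD F E e TV TW)}
    (hp : IsSiegelDelta F E c e TV TW (jA p)) (hq : IsSiegelDelta F E c e TV TW (jA q)) :
    (((chiDet F E c e TV TW χ (jA (p * q)) : ℂˣ) : ℂ) *
          (modDelta F E c e TV TW (jA (p * q)) : ℂ)) =
      (((chiDet F E c e TV TW χ (jA p) : ℂˣ) : ℂ) *
          (modDelta F E c e TV TW (jA p) : ℂ)) *
        (((chiDet F E c e TV TW χ (jA q) : ℂˣ) : ℂ) *
          (modDelta F E c e TV TW (jA q) : ℂ)) := by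
  rw [map_mul, chiDet_mul F E c e TV TW χ hp hq, modDelta_mul F E c e TV TW hp hq, Units.val_mul, Complex.ofReal_mul]
  ring

omit [NumberField F] [Algebra.IsQuadraticExtension F E] in
/-- the prescribed scalar is `≠ 0`. [cite: Kudla1994, §3] -/
theorem prescribed_ne_zero (χ : HeckeCharacter E) (p : UnitaryGroup.arch F E c (n + n) (hermD F E e TV TW)) :
    (((chiDet F E c e TV TW χ (jA p) : ℂˣ) : ℂ) *
          (modDelta F E c e TV TW (jA p) : ℂ)) ≠ 0 :=
  mul_ne_zero (Units.ne_zero _) (Complex.ofReal_ne_zero.2 (modDelta_ne_zero F E c e TV TW _))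

end Prescribed

/-! ## §3 The `𝕐`-block of `δ ι^𝔻(g,1) δ⁻¹` at `∞`: `0 < det d = |det_Δ (g,1)|` -/

section Modulus

variable [DecidableEq σ]

include hVd hWd hdiag in
/-- **the modulus input, read in the frame**: for `g ∈ P_Δ(L⁺ ⊗ ℝ)` the `𝕐`-block `d` of `δ ι^𝔻(g,1) δ⁻¹` at `∞` (in any real frame `eW`) has
`0 < det d` and `det d = (modDelta (g,1))² = |det_Δ (g,1)|_{𝔸_L}` (`d = ψ A ψ⁻¹` for the diagonal action `A` of
`ι^𝔻(g,1)`, `det A = ∏_w |det α_w|²`). [cite: Kudla1994, §3] -/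
theorem det_yBlock_pos_and_eq_modDelta_sq (g : UnitaryGroup.arch F E c (n + n) (hermD F E e TV TW))
    (hS : IsSiegelDelta F E c e TV TW (jA g))
    (d : (σ → ℝ) ≃ₗ[ℝ] (σ → ℝ))
    (hd : ∀ y, d y = (archPhaseMap (gramDA F e TV TW) eW (isUnit_archMat_gramDA F e TV hVd TW hWd)
      (ratSp F (gramDA F e TV TW) (isUnit_det_gramDA F e TV hVd TW hWd) (deltaD F) * ((toSpD F E c hcδ hδ hd e TV hV TW hW).comp jA) g *
        (ratSp F (gramDA F e TV TW) (isUnit_det_gramDA F e TV hVd TW hWd) (deltaD F))⁻¹) (0, y)).2) :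
    0 < LinearMap.det (d : (σ → ℝ) →ₗ[ℝ] (σ → ℝ)) ∧
      ((LinearMap.det (d : (σ → ℝ) →ₗ[ℝ] (σ → ℝ)) : ℝ) : ℂ) =
        ((modDelta F E c e TV TW (jA g) : ℝ) : ℂ) ^ 2 := by
  obtain ⟨A, hA, hpos, hsq⟩ := hdiag g hS
  rw [det_yBlock_eq_det F e TV hVd TW hWd eW _ A (fun az => hA az) d hd]
  exact ⟨hpos, hsq⟩

end Modulus

/-! ## §4 `P_Δ(L⁺ ⊗ ℝ)` is generated by squares; multiplicative scalars with equal squares agree -/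

section Squares

include hVd hWd hV hW hcδ hδ hjA in
/-- **every element of `P_Δ(F ⊗ ℝ) ≅ ∏_w GL_n(ℂ) ⋉ Herm_n` (`E` totally complex) is a product of squares of elements of `P_Δ(F ⊗ ℝ)`**
(the tree's `UnitaryGroup.exists_list_sq_of_isSiegel_archToAdelic_of_base` at `J^𝔻 = e₂ (T ⊕ −T) e₂ ⊗ L`,
`T = gramR` symmetric with unit determinant). [cite: Kudla1994, §3] -/
theorem exists_list_sq_of_isSiegelDelta_arch [IsTotallyComplex E] (p : UnitaryGroup.arch F E c (n + n) (hermD F E e TV TW))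
    (hp : IsSiegelDelta F E c e TV TW (jA p)) :
    ∃ l : List (UnitaryGroup.arch F E c (n + n) (hermD F E e TV TW)),
      (∀ q ∈ l, IsSiegelDelta F E c e TV TW (jA q)) ∧ p = (l.map fun q => q * q).prod := by
  subst hjA
  exact UnitaryGroup.exists_list_sq_of_isSiegel_archToAdelic_of_base F E c (n + n)
    (hermD F E e TV TW) (e₂ (n := n)) (fun x => UnitaryDualPair.LocalSplitting.galConj_apply_apply F E c hcδ hδ x)
    (T := gramR F e TV TW) (show (Matrix.reindex e e _).IsSymm from (UnitaryGroup.isSymm_kronecker hV hW).submatrix _)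
    (isUnit_det_gramR₀ F e TV hVd TW hWd) rfl p hp

end Squares

/-! ## §5 The origin value of `r_δ (sa ⊗ η)(g) r_δ⁻¹` on `P_Δ(L⁺ ⊗ ℝ)` -/

section Origin

variable [DecidableEq σ]

include hsa hdiag in
set_option maxHeartbeats 3200000 in
-- (the origin-value computation elaborates many `Mp(𝕎^𝔻)ᶜᵒⁿᵗ`/`𝓢` terms; instance unification is expensive)
/-- **the origin value of `r_δ (sa ⊗ η)(g) r_δ⁻¹` on `P_Δ(L⁺ ⊗ ℝ)`** is a scalar whose square is the square of the
prescribed one: `∃ κ, (ω(…)Φ)(0) = κ Φ(0) ∀ Φ` and `κ² = (χ(det_Δ (g,1)) |det_Δ (g,1)|^{1/2})²`, provided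
`η(g)² · quot(sW g) = χ(det_Δ (g,1))²` (Weil's value at the origin `u · |det a|^{-1/2}` of an implementer of `m(a) n(b)`,
`u² = quot`, and §3). [cite: Weil1964, Chap. III n° 46 (42) p. 202] -/
theorem exists_originValue_sq (χ : HeckeCharacter E) (η : UnitaryGroup.arch F E c (n + n) (hermD F E e TV TW) →* ℂˣ)
    (hη : ∀ g : UnitaryGroup.arch F E c (n + n) (hermD F E e TV TW), IsSiegelDelta F E c e TV TW (jA g) →
      ((η g : ℂˣ) : ℂ) ^ 2 * MpS.quot (sW g) = ((chiDet F E c e TV TW χ (jA g) : ℂˣ) : ℂ) ^ 2)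
    (A : SchwartzMap (Fin (n + n) → mixedEmbedding.mixedSpace F) ℂ ≃L[ℂ] SchwartzMap (Fin (n + n) → mixedEmbedding.mixedSpace F) ℂ) (P : FinSB F (Fin (n + n)) ≃ₗ[ℂ] FinSB F (Fin (n + n)))
    (hr : ∀ (Φ : SchwartzMap (Fin (n + n) → mixedEmbedding.mixedSpace F) ℂ) (f : FinSB F (Fin (n + n))),
      adelicMpCont.omega F (Fin (n + n)) (gramDA F e TV TW) (rDelta F e TV hVd TW hWd) (piSchwartzBruhatEquiv F (Fin (n + n)) (Φ ⊗ₜ f)) =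
        piSchwartzBruhatEquiv F (Fin (n + n)) (A Φ ⊗ₜ P f))
    (z : MpS σ)
    (hz' : (⇑((MpS.proj z).1 : ((σ → ℝ) × (σ → ℝ)) ≃ₗ[ℝ] ((σ → ℝ) × (σ → ℝ))) : ((σ → ℝ) × (σ → ℝ)) → ((σ → ℝ) × (σ → ℝ))) =
      archPhaseMap (gramDA F e TV TW) eW (isUnit_archMat_gramDA F e TV hVd TW hWd) (adelicMpCont.proj F (Fin (n + n)) (gramDA F e TV TW) (rDelta F e TV hVd TW hWd)))
    (g : UnitaryGroup.arch F E c (n + n) (hermD F E e TV TW)) (hS : IsSiegelDelta F E c e TV TW (jA g)) :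
    ∃ κ : ℂ, (∀ Φ, opD F e TV TW (rDelta F e TV hVd TW hWd * adelicMpCont.twist F (Fin (n + n)) (gramDA F e TV TW) sa η g * (rDelta F e TV hVd TW hWd)⁻¹) Φ 0 =
        κ * (Φ : (Fin (n + n) → AdeleRing (𝓞 F) F) → ℂ) 0) ∧
      κ ^ 2 = ((((chiDet F E c e TV TW χ (jA g) : ℂˣ) : ℂ) *
          (modDelta F E c e TV TW (jA g) : ℂ))) ^ 2 := by
  have hπr : adelicMpCont.proj F (Fin (n + n)) (gramDA F e TV TW) (rDelta F e TV hVd TW hWd) =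
      ratSp F (gramDA F e TV TW) (isUnit_det_gramDA F e TV hVd TW hWd) (deltaD F) :=
    projD_rDelta F e TV hVd TW hWd
  have hSi : IsSiegelDelta F E c e TV TW (jA g⁻¹) := by
    rw [map_inv]; exact isSiegelDelta_inv F E c e TV TW hS
  have hq : ∀ y : Fin (n + n) → AdeleRing (𝓞 F) F,
      ((adelicMpCont.proj F (Fin (n + n)) (gramDA F e TV TW) (rDelta F e TV hVd TW hWd) * ((toSpD F E c hcδ hδ hd e TV hV TW hW).comp jA) g *
          (adelicMpCont.proj F (Fin (n + n)) (gramDA F e TV TW) (rDelta F e TV hVd TW hWd))⁻¹).1 (0, y)).1 = 0 := by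
    intro y; rw [hπr]; exact conj_deltaD_toSpD_apply_zero_fst F E c hcδ hδ hd e TV hV hVd TW hW hWd _ hS y
  have hq' : ∀ y : Fin (n + n) → AdeleRing (𝓞 F) F,
      ((adelicMpCont.proj F (Fin (n + n)) (gramDA F e TV TW) (rDelta F e TV hVd TW hWd) * ((toSpD F E c hcδ hδ hd e TV hV TW hW).comp jA) g *
          (adelicMpCont.proj F (Fin (n + n)) (gramDA F e TV TW) (rDelta F e TV hVd TW hWd))⁻¹)⁻¹.1 (0, y)).1 = 0 := by
    intro y
    have hinv : (adelicMpCont.proj F (Fin (n + n)) (gramDA F e TV TW) (rDelta F e TV hVd TW hWd) * ((toSpD F E c hcδ hδ hd e TV hV TW hW).comp jA) g *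
          (adelicMpCont.proj F (Fin (n + n)) (gramDA F e TV TW) (rDelta F e TV hVd TW hWd))⁻¹)⁻¹ =
        ratSp F (gramDA F e TV TW) (isUnit_det_gramDA F e TV hVd TW hWd) (deltaD F) * toSpD F E c hcδ hδ hd e TV hV TW hW (jA g⁻¹) *
          (ratSp F (gramDA F e TV TW) (isUnit_det_gramDA F e TV hVd TW hWd) (deltaD F))⁻¹ := by
      rw [hπr]
      show (_ * toSpD F E c hcδ hδ hd e TV hV TW hW (jA g) * _)⁻¹ = _
      rw [map_inv jA g, map_inv (toSpD F E c hcδ hδ hd e TV hV TW hW)]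
      group
    rw [hinv]; exact conj_deltaD_toSpD_apply_zero_fst F E c hcδ hδ hd e TV hV hVd TW hW hWd _ hSi y
  obtain ⟨a, d, had, b, hb, u, hu, hdec, -, hwu, hval⟩ :=
    exists_siegel_of_conj (gramDA F e TV TW) eW (isUnit_archMat_gramDA F e TV hVd TW hWd) ((toSpD F E c hcδ hδ hd e TV hV TW hW).comp jA) sW hdict (rDelta F e TV hVd TW hWd) z hz' g hq hq'
  have hdy : ∀ y, d y = (archPhaseMap (gramDA F e TV TW) eW (isUnit_archMat_gramDA F e TV hVd TW hWd)
      (ratSp F (gramDA F e TV TW) (isUnit_det_gramDA F e TV hVd TW hWd) (deltaD F) * ((toSpD F E c hcδ hδ hd e TV hV TW hW).comp jA) g *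
        (ratSp F (gramDA F e TV TW) (isUnit_det_gramDA F e TV hVd TW hWd) (deltaD F))⁻¹) (0, y)).2 := by
    intro y
    rw [levi_snd_eq_archPhaseMap (gramDA F e TV TW) eW (isUnit_archMat_gramDA F e TV hVd TW hWd) ((toSpD F E c hcδ hδ hd e TV hV TW hW).comp jA) sW hdict (rDelta F e TV hVd TW hWd) z hz' g hdec y, hπr]
  obtain ⟨hdetd, hmodd⟩ := det_yBlock_pos_and_eq_modDelta_sq F E c hcδ hδ hd e TV hV hVd TW hW hWd jA eW hdiag g hS d hdy
  have hdet : 0 < LinearMap.det (a : (σ → ℝ) →ₗ[ℝ] (σ → ℝ)) := (det_pos_iff_of_dual a d had).2 hdetd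
  have hmod : leviFactor a ^ 2 = ((modDelta F E c e TV TW (jA g) : ℝ) : ℂ) ^ 2 :=
    (leviFactor_sq_eq_det a d had hdetd).trans hmodd
  have hu2 : u ^ 2 = MpS.quot (sW g) := sq_originValue_eq_quot sW z g hdet hwu
  -- the origin value of the untwisted conjugate
  subst hsa
  have h0 : ∀ Ψ : piSchwartzBruhat F (Fin (n + n)),
      ((adelicMpCont.omega F (Fin (n + n)) (gramDA F e TV TW)
          (rDelta F e TV hVd TW hWd * archLift (gramDA F e TV TW) eW (isUnit_archMat_gramDA F e TV hVd TW hWd)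
        ((toSpD F E c hcδ hδ hd e TV hV TW hW).comp jA) sW hfin hdict g *
            (rDelta F e TV hVd TW hWd)⁻¹) Ψ : piSchwartzBruhat F (Fin (n + n))) : (Fin (n + n) → AdeleRing (𝓞 F) F) → ℂ) 0 =
        (u * leviFactor a) * (Ψ : (Fin (n + n) → AdeleRing (𝓞 F) F) → ℂ) 0 :=
    fun Ψ => omega_conj_archLift_apply_zero (gramDA F e TV TW) eW (isUnit_archMat_gramDA F e TV hVd TW hWd) ((toSpD F E c hcδ hδ hd e TV hV TW hW).comp jA) sW hfin hdict (rDelta F e TV hVd TW hWd) A P hr z hz' g hval Ψ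
  refine ⟨((η g : ℂˣ) : ℂ) * (u * leviFactor a), fun Φ => ?_, ?_⟩
  · rw [conj_twist_eq, opD_mul]
    simp only [opD, adelicMpCont.omega_ofScalar, Submodule.coe_smul, Pi.smul_apply, smul_eq_mul]
    rw [h0]
    ring
  · rw [mul_pow, mul_pow, hu2, ← mul_assoc, hη g hS, hmod, ← mul_pow]

end Origin

/-! ## §6 The parabolic prescription and the archimedean half -/

section Parabolic

variable [DecidableEq σ]

include hsa hjA hdiag in
set_option maxHeartbeats 1600000 in
-- (the assembly elaborates many `Mp(𝕎^𝔻)ᶜᵒⁿᵗ`/`𝓢` terms; instance unification is expensive)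
/-- **`sa ⊗ η` has the prescribed origin values `χ(det_Δ (g,1)) |det_Δ (g,1)|^{1/2}` on `P_Δ(L⁺ ⊗ ℝ)`** whenever
`η(g)² · quot(sW g) = χ(det_Δ (g,1))²` there: the origin value of `r_δ (sa ⊗ η)(g) r_δ⁻¹` is a multiplicative scalar on
`P_Δ(L⁺ ⊗ ℝ)` (§5) with the square of the prescribed (multiplicative, non-vanishing) one, and `P_Δ(L⁺ ⊗ ℝ)` is
generated by squares (§4). [cite: GelbartRogawski1991, §3.1 Prop. 3.1.1 p. 455] -/
theorem parabolicPrescribed_twist [IsTotallyComplex E] (χ : HeckeCharacter E) (η : UnitaryGroup.arch F E c (n + n) (hermD F E e TV TW) →* ℂˣ)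
    (hη : ∀ g : UnitaryGroup.arch F E c (n + n) (hermD F E e TV TW), IsSiegelDelta F E c e TV TW (jA g) →
      ((η g : ℂˣ) : ℂ) ^ 2 * MpS.quot (sW g) = ((chiDet F E c e TV TW χ (jA g) : ℂˣ) : ℂ) ^ 2) :
    ParabolicPrescribed F E c e TV hVd TW hWd jA χ (adelicMpCont.twist F (Fin (n + n)) (gramDA F e TV TW) sa η) := by
  -- (1) the tensor form of `ω(r_F^𝔻(δ))` and a metaplectic reading `z` of `δ_∞`
  obtain ⟨A, P, hr⟩ := exists_omega_tmul (gramDA F e TV TW)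
    (mulVec_surjective_of_isUnit_det F (gramDA F e TV TW) (isUnit_det_gramDA F e TV hVd TW hWd)) (rDelta F e TV hVd TW hWd)
  obtain ⟨z, hz⟩ := exists_MpS_over_archPhaseMap (gramDA F e TV TW) eW (isUnit_archMat_gramDA F e TV hVd TW hWd)
    (ratSp F (gramDA F e TV TW) (isUnit_det_gramDA F e TV hVd TW hWd) (deltaD F))
  have hπr : adelicMpCont.proj F (Fin (n + n)) (gramDA F e TV TW) (rDelta F e TV hVd TW hWd) =
      ratSp F (gramDA F e TV TW) (isUnit_det_gramDA F e TV hVd TW hWd) (deltaD F) :=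
    projD_rDelta F e TV hVd TW hWd
  have hz' : (⇑((MpS.proj z).1 : ((σ → ℝ) × (σ → ℝ)) ≃ₗ[ℝ] ((σ → ℝ) × (σ → ℝ))) : ((σ → ℝ) × (σ → ℝ)) → ((σ → ℝ) × (σ → ℝ))) =
      archPhaseMap (gramDA F e TV TW) eW (isUnit_archMat_gramDA F e TV hVd TW hWd) (adelicMpCont.proj F (Fin (n + n)) (gramDA F e TV TW) (rDelta F e TV hVd TW hWd)) := by
    rw [hπr]; exact hz
  have horig := fun g hS =>
    exists_originValue_sq F E c hcδ hδ hd e TV hV hVd TW hW hWd jA eW sW hfin hdict sa hsa hdiag χ η hη A P hr z hz' g hS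
  -- (2) the origin-value scalar `c` on `P_Δ(L⁺ ⊗ ℝ)` and its multiplicativity
  obtain ⟨Φ₀, hΦ₀⟩ : ∃ Φ : piSchwartzBruhat F (Fin (n + n)),
      (Φ : (Fin (n + n) → AdeleRing (𝓞 F) F) → ℂ) 0 ≠ 0 := by
    -- the pure tensor `unitSchwartz ⊗ 𝟙_{𝒪̂^{n+n}}`
    refine ⟨piSchwartzBruhatEquiv F (Fin (n + n)) (unitSchwartz F (Fin (n + n)) ⊗ₜ[ℂ]
      indicatorSB F (Fin (n + n)) (piLevelIdeal F (Fin (n + n)) ⊤) (isOpen_piLevelIdeal F ⊤)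
        (isCompact_piLevelIdeal F (Fin (n + n)) ⊤)), ?_⟩
    rw [coe_piSchwartzBruhatEquiv_tmul]
    have h0 : piArch F (Fin (n + n)) 0 = 0 := by
      funext i
      rw [piArch_apply, Pi.zero_apply]
      exact map_zero (InfiniteAdeleRing.ringEquiv_mixedSpace F)
    have h1 : piFinite F (Fin (n + n)) 0 = 0 := rfl
    simp only [h0, h1, unitSchwartz_apply_zero, one_mul, coe_indicatorSB]
    rw [Set.indicator_of_mem (show (0 : Fin (n + n) → FiniteAdeleRing (𝓞 F) F) ∈
      (piLevelIdeal F (Fin (n + n)) ⊤ : Set _) from (piLevelIdeal F (Fin (n + n)) ⊤).zero_mem)]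
    exact one_ne_zero
  let S : Set (UnitaryGroup.arch F E c (n + n) (hermD F E e TV TW)) := {g | IsSiegelDelta F E c e TV TW (jA g)}
  let κ : UnitaryGroup.arch F E c (n + n) (hermD F E e TV TW) → ℂ := fun g =>
    if h : IsSiegelDelta F E c e TV TW (jA g) then Classical.choose (horig g h) else 1
  let τ : UnitaryGroup.arch F E c (n + n) (hermD F E e TV TW) → ℂ := fun g =>
    (((chiDet F E c e TV TW χ (jA g) : ℂˣ) : ℂ) *
          (modDelta F E c e TV TW (jA g) : ℂ))
  have hcval : ∀ g ∈ S, ∀ Φ, opD F e TV TW (rDelta F e TV hVd TW hWd * adelicMpCont.twist F (Fin (n + n)) (gramDA F e TV TW) sa η g * (rDelta F e TV hVd TW hWd)⁻¹) Φ 0 =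
      κ g * (Φ : (Fin (n + n) → AdeleRing (𝓞 F) F) → ℂ) 0 := by
    intro g hg Φ
    have h : IsSiegelDelta F E c e TV TW (jA g) := hg
    simp only [κ, dif_pos h]
    exact (Classical.choose_spec (horig g h)).1 Φ
  have hcsq : ∀ g ∈ S, κ g ^ 2 = τ g ^ 2 := by
    intro g hg
    have h : IsSiegelDelta F E c e TV TW (jA g) := hg
    simp only [κ, τ, dif_pos h]
    exact (Classical.choose_spec (horig g h)).2
  have hS1 : (1 : UnitaryGroup.arch F E c (n + n) (hermD F E e TV TW)) ∈ S := by
    show IsSiegelDelta F E c e TV TW (jA 1)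
    rw [map_one]; exact isSiegelDelta_one' F E c e TV TW
  have hSmul : ∀ p ∈ S, ∀ q ∈ S, p * q ∈ S := by
    intro p hp q hq
    show IsSiegelDelta F E c e TV TW (jA (p * q))
    rw [map_mul]; exact isSiegelDelta_mul F E c e TV TW hp hq
  have hc : ∀ p ∈ S, ∀ q ∈ S, κ (p * q) = κ p * κ q := by
    intro p hp q hq
    have h1 := hcval (p * q) (hSmul p hp q hq) Φ₀
    rw [conj_twist_mul, opD_mul] at h1
    have h2 := hcval p hp (adelicMpCont.omega F (Fin (n + n)) (gramDA F e TV TW)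
      (rDelta F e TV hVd TW hWd * adelicMpCont.twist F (Fin (n + n)) (gramDA F e TV TW) sa η q *
        (rDelta F e TV hVd TW hWd)⁻¹) Φ₀)
    have h3 := hcval q hq Φ₀
    have h4 : κ (p * q) * (Φ₀ : (Fin (n + n) → AdeleRing (𝓞 F) F) → ℂ) 0 =
        κ p * (κ q * (Φ₀ : (Fin (n + n) → AdeleRing (𝓞 F) F) → ℂ) 0) := by
      rw [← h3, ← h1]
      exact h2
    rw [← mul_assoc] at h4
    exact mul_right_cancel₀ hΦ₀ h4
  have hτ : ∀ p ∈ S, ∀ q ∈ S, τ (p * q) = τ p * τ q :=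
    fun p hp q hq => prescribed_mul F E c e TV TW jA χ hp hq
  have hτ0 : ∀ p ∈ S, τ p ≠ 0 := fun p _ => prescribed_ne_zero F E c e TV TW jA χ p
  have hgen : ∀ p ∈ S, ∃ l : List (UnitaryGroup.arch F E c (n + n) (hermD F E e TV TW)), (∀ q ∈ l, q ∈ S) ∧ p = (l.map fun q => q * q).prod :=
    fun p hp => exists_list_sq_of_isSiegelDelta_arch F E c hcδ hδ e TV hV hVd TW hW hWd jA hjA p hp
  have hcτ := GRConstruction.eq_of_sq_eq_of_prod_squares S hS1 hSmul κ τ hc hτ hτ0 hcsq hgen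
  -- (3) conclusion
  intro g hS _ Φ
  exact (hcval g hS Φ).trans (by rw [hcτ g hS])

include hsa hjA hdiag in
/-- **THE ARCHIMEDEAN HALF FROM A FOLLAND-FRAMED SECTION** (`E` totally complex): for a continuous character `η` of `H(L⁺ ⊗ ℝ)` with
`η(g)² · quot(sW g) = χ(det_Δ (g,1))²` on `P_Δ(L⁺ ⊗ ℝ)`, the twist `sa ⊗ η` of the archimedean lift `sa` of `(eW, sW)`
is an archimedean half of the doubled Weil representation: `IsArchHalf χ (sa ⊗ η)`. [cite: GelbartRogawski1991, §3.1 Prop. 3.1.1 p. 455] -/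
theorem isArchHalf_twist_archLift [IsTotallyComplex E] (χ : HeckeCharacter E) (hcont : Continuous sa) (η : UnitaryGroup.arch F E c (n + n) (hermD F E e TV TW) →* ℂˣ)
    (hηc : Continuous fun g => ((η g : ℂˣ) : ℂ))
    (hη : ∀ g : UnitaryGroup.arch F E c (n + n) (hermD F E e TV TW), IsSiegelDelta F E c e TV TW (jA g) →
      ((η g : ℂˣ) : ℂ) ^ 2 * MpS.quot (sW g) = ((chiDet F E c e TV TW χ (jA g) : ℂˣ) : ℂ) ^ 2) :
    IsArchHalf F E c hcδ hδ hd e TV hV hVd TW hW hWd χ (adelicMpCont.twist F (Fin (n + n)) (gramDA F e TV TW) sa η) :=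
  isArchHalf_twist F E c hcδ hδ hd e TV hV hVd TW hW hWd jA hjA eW sW hfin hdict sa hsa χ hcont η hηc
    (parabolicPrescribed_twist F E c hcδ hδ hd e TV hV hVd TW hW hWd jA hjA eW sW hfin hdict sa hsa hdiag χ η hη)

end Parabolic

end Literature.NumberTheory.GelbartRogawski1991.GRConstructionGen

end
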